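import Summits.HodgeConjecture.HodgeConjecture.Theorems.F0P3cStCharTSWeylCartanRadial   -- ★ `isRegularElt_conj_val_iff`, `measurableSet_setOf_isRegularElt` (regular locus of `U(Φ₃)(L⁺_v)`)
import Summits.HodgeConjecture.HodgeConjecture.Theorems.F0P3cStCharTSSingularNull       -- ★ J8 `measure_setOf_not_isRegularElt_Gqs_eq_zero_of_forall` (the singular locus is Haar-null)
import HarnessLib

/-!
# F0 · P3c · ROAD «UP-TR» (A1′) carve (X1) «REGULAR LOCALISATION»: integrals against `up`-type integrands live on the regular locus, and orbit sums of a
# Cartan subgroup live on its `T`-regular set (Rogawski 1990 §12.5 pp. 182–183, the first line of the proof of Lemma 12.5.1)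

Cell `pub/hodgecm-mathlib`, crux H413 = `stmt-HodgeConjecture-24833` (lane `--supports … --as helper`); seat LH10-p02 (g10), co-hand of (A1′) «UP-TR ASSEMBLY»
(pen LH10-p01 (g8), CENSUS (A1′) 42cf0f1d §2 carve (X1); holder F0P3-p02 (g23) 2026-09-02T19:13:15Z).  THEOREMS ONLY; sorry-free; no definition ∕ instance ∕ notation ∕
named fact; ★-only imports; axioms TRIO.  `G = Gqs L v = U(Φ₃)(L⁺_v)`, regular locus `G^{reg} = {g | IsRegularElt g.val}`, and for a subgroup `T ≤ G` the `T`-regular set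
`G_T = {x | ∃ g t, t ∈ T ∧ IsRegularElt t.val ∧ g t g⁻¹ = x}` and the orbit sum `y ↦ ∑ᶠ t : ↥T, 𝟙[↑t ∼ y] K t` (tokens of ★ (N4)(c) `…UpTrTubeOrbitSum`).

* §1 (a) **`integral_mul_ite_isRegularElt_eq_setIntegral`**: `∫ f·(if regular then E else 0) = ∫_{G^{reg}} f·(if regular then E else 0)` (the integrand vanishes off `G^{reg}`; no
  measure theory), **`setIntegral_mul_ite_isRegularElt_eq`**: `= ∫_{G^{reg}} f·E` (`G^{reg}` Borel, ★ `measurableSet_setOf_isRegularElt`), and their composite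
  **`integral_mul_ite_isRegularElt_eq_setIntegral_mul`** — the `upC α` integrand of ★ (P1) `…UpTrDatumDict` is literally `if IsRegularElt g.val then E g else 0`;
  (a′) **`setIntegral_setOf_isRegularElt_eq_integral`**: `∫_{G^{reg}} F = ∫ F` for EVERY `F` and every Haar `ν` (★ J8: the singular locus is `ν`-null).
* §2 (b) **`setIntegral_mul_orbitSum_setOf_isRegularElt_eq_cartanSet`**: `∫_{G^{reg}} f · orbitSum_T K = ∫_{G_T} f · orbitSum_T K` for ANY subgroup `T` and ANY `K` — `G_T ⊆ G^{reg}`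
  (★ `isRegularElt_conj_val_iff`) and on a regular `y ∉ G_T` no `t ∈ T` is conjugate to `y` (such a `t` would be regular and exhibit `y ∈ G_T`), so the orbit sum vanishes
  (**`orbitSum_eq_zero_of_not_mem_cartanSet`**); with (a′): **`integral_mul_orbitSum_eq_setIntegral_cartanSet`** `∫ f · orbitSum_T K ∂ν = ∫_{G_T} f · orbitSum_T K ∂ν`.

HONEST LABEL: count-neutral; closes no organ.  HC_CM is proved only modulo the 7 printed citations (2 remaining: hLiu418 = `stmt-HodgeConjecture-24832`,
h413 = `stmt-HodgeConjecture-24833`) until rung 0 closes.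

## References
* [Rogawski1990] J. D. Rogawski, *Automorphic Representations of Unitary Groups in Three Variables*, Ann. of Math. Stud. 123 (1990), §12.5 pp. 182–183; §3.1 p. 19.
* [HarishChandra1970] Harish-Chandra (notes by G. van Dijk), *Harmonic analysis on reductive p-adic groups*, LNM 162 (1970), Lemma 42.
-/

set_option autoImplicit false
-- the mandated namespace has the single-problem summit's repeated segment (`HodgeConjecture.HodgeConjecture`)
set_option linter.dupNamespace false

noncomputable section

open MeasureTheory Measure Set Filter Topology Function NumberField IsDedekindDomain
open Literature.NumberTheory.Automorphic Literature.NumberTheory.Automorphic.UnitaryGroup Literature.NumberTheory.Rogawski1990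
open Summit.HodgeConjecture.HodgeConjecture.Cruxes.H413.F0P3cStCharTSWeylCartanRadial
open Summit.HodgeConjecture.HodgeConjecture.Cruxes.H413.F0P3cStCharTSSingularNull
open scoped ENNReal NNReal MatrixGroups Classical

namespace Summit.HodgeConjecture.HodgeConjecture.Cruxes.H413.F0P3cStCharTSUpTrRegularLoc

section CM

variable (L : Type) [Field L] [NumberField L] [IsCMField L] (v : HeightOneSpectrum (𝓞 ↥(maximalRealSubfield L)))

/-! ## §1 Integrands supported on the regular locus -/

/-- **(X1)(a) An integrand `f · (if regular then E else 0)` integrates over the regular locus**: `∫_G = ∫_{G^{reg}}` (it vanishes off `G^{reg}`; no measurability needed).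
[cite: Rogawski1990, §12.5 p. 182] -/
theorem integral_mul_ite_isRegularElt_eq_setIntegral [MeasurableSpace (Gqs L v)] (ν : Measure (Gqs L v)) (f E : Gqs L v → ℂ) :
    ∫ g, f g * (if IsRegularElt (g.val : GL (Fin 3) (UnitaryGroup.LocalRing L v)) then E g else 0) ∂ν =
      ∫ g in {g : Gqs L v | IsRegularElt (g.val : GL (Fin 3) (UnitaryGroup.LocalRing L v))},
        f g * (if IsRegularElt (g.val : GL (Fin 3) (UnitaryGroup.LocalRing L v)) then E g else 0) ∂ν := by
  symm
  refine setIntegral_eq_integral_of_forall_compl_eq_zero fun g hg => ?_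
  have hg' : ¬ IsRegularElt (g.val : GL (Fin 3) (UnitaryGroup.LocalRing L v)) := hg
  rw [if_neg hg', mul_zero]

/-- **(X1)(a) On the regular locus the `if` disappears**: `∫_{G^{reg}} f·(if regular then E else 0) = ∫_{G^{reg}} f·E` (`G^{reg}` is Borel at a non-split place, ★
`measurableSet_setOf_isRegularElt`). [cite: Rogawski1990, §12.5 p. 182; §3.1 p. 19] -/
theorem setIntegral_mul_ite_isRegularElt_eq (hns : ∀ w : PlacesOver L v, IsCMField.complexConj L • w.1 = w.1)
    [MeasurableSpace (Gqs L v)] [BorelSpace (Gqs L v)] (ν : Measure (Gqs L v)) (f E : Gqs L v → ℂ) :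
    ∫ g in {g : Gqs L v | IsRegularElt (g.val : GL (Fin 3) (UnitaryGroup.LocalRing L v))},
        f g * (if IsRegularElt (g.val : GL (Fin 3) (UnitaryGroup.LocalRing L v)) then E g else 0) ∂ν =
      ∫ g in {g : Gqs L v | IsRegularElt (g.val : GL (Fin 3) (UnitaryGroup.LocalRing L v))}, f g * E g ∂ν := by
  refine setIntegral_congr_fun (measurableSet_setOf_isRegularElt L v hns) fun g hg => ?_
  rw [mem_setOf_eq] at hg
  simp only [if_pos hg]

/-- **(X1)(a), composite**: `∫_G f·(if regular then E else 0) = ∫_{G^{reg}} f·E`. [cite: Rogawski1990, §12.5 p. 182] -/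
theorem integral_mul_ite_isRegularElt_eq_setIntegral_mul (hns : ∀ w : PlacesOver L v, IsCMField.complexConj L • w.1 = w.1)
    [MeasurableSpace (Gqs L v)] [BorelSpace (Gqs L v)] (ν : Measure (Gqs L v)) (f E : Gqs L v → ℂ) :
    ∫ g, f g * (if IsRegularElt (g.val : GL (Fin 3) (UnitaryGroup.LocalRing L v)) then E g else 0) ∂ν =
      ∫ g in {g : Gqs L v | IsRegularElt (g.val : GL (Fin 3) (UnitaryGroup.LocalRing L v))}, f g * E g ∂ν := by
  rw [integral_mul_ite_isRegularElt_eq_setIntegral L v ν f E, setIntegral_mul_ite_isRegularElt_eq L v hns ν f E]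

/-- **(X1)(a′) The singular locus is negligible**: `∫_{G^{reg}} F ∂ν = ∫_G F ∂ν` for every `F` and every Haar measure `ν` (★ J8 `measure_setOf_not_isRegularElt_Gqs_eq_zero_of_forall`).
[cite: Rogawski1990, §12.5 p. 182; §3.6 p. 29] -/
theorem setIntegral_setOf_isRegularElt_eq_integral (hns : ∀ w : PlacesOver L v, IsCMField.complexConj L • w.1 = w.1)
    [MeasurableSpace (Gqs L v)] [BorelSpace (Gqs L v)] (ν : Measure (Gqs L v)) [ν.IsHaarMeasure] (F : Gqs L v → ℂ) :
    ∫ g in {g : Gqs L v | IsRegularElt (g.val : GL (Fin 3) (UnitaryGroup.LocalRing L v))}, F g ∂ν = ∫ g, F g ∂ν := by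
  refine setIntegral_eq_integral_of_ae_compl_eq_zero ?_
  have h0 := measure_setOf_not_isRegularElt_Gqs_eq_zero_of_forall L v hns ν
  filter_upwards [compl_mem_ae_iff.2 h0] with g hg hg'
  exact (hg hg').elim

/-! ## §2 Orbit sums of a subgroup live on its `T`-regular set -/

/-- `G_T ⊆ G^{reg}`: a conjugate of a regular element of `T` is regular (★ `isRegularElt_conj_val_iff`). [cite: Rogawski1990, §3.1 p. 19] -/
theorem cartanSet_subset_setOf_isRegularElt (T : Subgroup (Gqs L v)) :
    {x : Gqs L v | ∃ g t : Gqs L v, t ∈ T ∧ IsRegularElt (t.val : GL (Fin 3) (UnitaryGroup.LocalRing L v)) ∧ g * t * g⁻¹ = x} ⊆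
      {g : Gqs L v | IsRegularElt (g.val : GL (Fin 3) (UnitaryGroup.LocalRing L v))} := by
  rintro x ⟨g, t, -, ht, rfl⟩
  exact (isRegularElt_conj_val_iff L v g t).2 ht

/-- **On a regular `y ∉ G_T` the orbit sum of `T` vanishes**: a `t ∈ T` conjugate to `y` would be regular (★ `isRegularElt_conj_val_iff`) and exhibit `y ∈ G_T`. [cite: Rogawski1990, §12.5 p. 182]
[cite: HarishChandra1970, Lemma 42] -/
theorem orbitSum_eq_zero_of_not_mem_cartanSet (T : Subgroup (Gqs L v)) (K : ↥T → ℂ) {y : Gqs L v}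
    (hy : IsRegularElt (y.val : GL (Fin 3) (UnitaryGroup.LocalRing L v)))
    (hyT : y ∉ {x : Gqs L v | ∃ g t : Gqs L v, t ∈ T ∧ IsRegularElt (t.val : GL (Fin 3) (UnitaryGroup.LocalRing L v)) ∧ g * t * g⁻¹ = x}) :
    ∑ᶠ t : ↥T, {t' : ↥T | IsConj ((t' : Gqs L v)) y}.indicator K t = 0 := by
  have h : (fun t : ↥T => {t' : ↥T | IsConj ((t' : Gqs L v)) y}.indicator K t) = fun _ => 0 := by
    funext t
    refine indicator_of_notMem (fun ht => hyT ?_) K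
    obtain ⟨c, hc⟩ := isConj_iff.1 ht
    refine ⟨c, (t : Gqs L v), t.2, ?_, hc⟩
    rw [← isRegularElt_conj_val_iff L v c (t : Gqs L v), hc]
    exact hy
  rw [h, finsum_zero]

/-- **(X1)(b) `∫_{G^{reg}} f · orbitSum_T K = ∫_{G_T} f · orbitSum_T K`** for every subgroup `T ≤ U(Φ₃)(L⁺_v)`, every `f` and every `K : T → ℂ` (no integrability needed: the two
integrands agree off a set where both vanish). [cite: Rogawski1990, §12.5 pp. 182–183] [cite: HarishChandra1970, Lemma 42] -/
theorem setIntegral_mul_orbitSum_setOf_isRegularElt_eq_cartanSet (hns : ∀ w : PlacesOver L v, IsCMField.complexConj L • w.1 = w.1)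
    [MeasurableSpace (Gqs L v)] [BorelSpace (Gqs L v)] (ν : Measure (Gqs L v)) (T : Subgroup (Gqs L v)) (f : Gqs L v → ℂ) (K : ↥T → ℂ) :
    ∫ y in {g : Gqs L v | IsRegularElt (g.val : GL (Fin 3) (UnitaryGroup.LocalRing L v))},
        f y * ∑ᶠ t : ↥T, {t' : ↥T | IsConj ((t' : Gqs L v)) y}.indicator K t ∂ν =
      ∫ y in {x : Gqs L v | ∃ g t : Gqs L v, t ∈ T ∧ IsRegularElt (t.val : GL (Fin 3) (UnitaryGroup.LocalRing L v)) ∧ g * t * g⁻¹ = x},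
        f y * ∑ᶠ t : ↥T, {t' : ↥T | IsConj ((t' : Gqs L v)) y}.indicator K t ∂ν := by
  refine setIntegral_eq_of_subset_of_forall_sdiff_eq_zero (measurableSet_setOf_isRegularElt L v hns) (cartanSet_subset_setOf_isRegularElt L v T)
    fun y hy => ?_
  rw [orbitSum_eq_zero_of_not_mem_cartanSet L v T K hy.1 hy.2, mul_zero]

/-- **(X1)(b′) `∫_G f · orbitSum_T K ∂ν = ∫_{G_T} f · orbitSum_T K ∂ν`** for a Haar measure `ν` (§1 (a′) + (b)). [cite: Rogawski1990, §12.5 pp. 182–183] -/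
theorem integral_mul_orbitSum_eq_setIntegral_cartanSet (hns : ∀ w : PlacesOver L v, IsCMField.complexConj L • w.1 = w.1)
    [MeasurableSpace (Gqs L v)] [BorelSpace (Gqs L v)] (ν : Measure (Gqs L v)) [ν.IsHaarMeasure] (T : Subgroup (Gqs L v)) (f : Gqs L v → ℂ) (K : ↥T → ℂ) :
    ∫ y, f y * ∑ᶠ t : ↥T, {t' : ↥T | IsConj ((t' : Gqs L v)) y}.indicator K t ∂ν =
      ∫ y in {x : Gqs L v | ∃ g t : Gqs L v, t ∈ T ∧ IsRegularElt (t.val : GL (Fin 3) (UnitaryGroup.LocalRing L v)) ∧ g * t * g⁻¹ = x},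
        f y * ∑ᶠ t : ↥T, {t' : ↥T | IsConj ((t' : Gqs L v)) y}.indicator K t ∂ν := by
  rw [← setIntegral_setOf_isRegularElt_eq_integral L v hns ν, setIntegral_mul_orbitSum_setOf_isRegularElt_eq_cartanSet L v hns ν T f K]

end CM

end Summit.HodgeConjecture.HodgeConjecture.Cruxes.H413.F0P3cStCharTSUpTrRegularLoc

end
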